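import Mathlib
import HarnessLib
import Summits.KontsevichZagierPeriods.KontsevichZagierPeriods.Theses.LinRedNormalForm
import Summits.KontsevichZagierPeriods.KontsevichZagierPeriods.Theorems.LinRedNormalFormDihedralNormalFormStubDilationNLAux1
import Summits.KontsevichZagierPeriods.KontsevichZagierPeriods.Theorems.LinRedNormalFormDihedralNormalFormStubDilationNLAux2

/-!
# `DihedralNormalForm`, line `torus-descent-sum-shadow`, stub `stub_dilationNL` — the chart on the simplex (Aux 3)

Support file for the stub `stub_dilationNL` (the Euler / dilation Newton–Leibniz move on the open
ordered simplex `Δᵏ⁺¹ = {1 > t₀ > ⋯ > t_k > 0}`) of the crux `DihedralNormalForm`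
(stmt-KontsevichZagierPeriods-3912, route `LinRedNormalForm`).  The geometry of the dilation chart
`dch m` (Aux 2) on the ordered simplex:

* edge inequalities of the ordered simplex around the slot `m` (`hiEdge`, `loEdge` of
  `VertexSplitting`);
* the scaled tuples `sc m c y` (the coordinates from the slot on multiplied by `c`) and the
  description of both charts on inserted tuples (`dch_insertNth`, `dinv_insertNth`);
* **the image of the simplex** under the chart is the open band
  `oband m = {t | (tⱼ)_{j ≠ m} ∈ Δᵏ, 0 < t_m < H}` (`image_dch`), i.e. the chart straightens the
  dilation orbits onto the `t_m`-axis over the ordered `k`-simplex;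
* the closed band `cband0 m`, its reading through the relabelling `reix m` (`p ↦ last`), and
  semialgebraicity.

References: M. Kontsevich, D. Zagier, *Periods* (2001), §1.2 (rule (2)).
-/

noncomputable section

open MeasureTheory Set MvPolynomial

namespace Summit.KontsevichZagierPeriods.DihedralNormalForm.TorusDescent

open Literature.NumberTheory.Transcendental
open Literature.ModelTheory.ExponentialFields
open Summit.KontsevichZagierPeriods.DihedralNormalForm.VertexSplitting
open Summit.KontsevichZagierPeriods.FurushoPentagon.HoffmanRelationInKZ

namespace Dilation

variable {k : ℕ} (m : Fin (k + 1))

/-! ### Edge inequalities on the ordered simplex -/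

/-- The upper edge is positive. -/
theorem hiEdge_pos {y : Fin k → ℝ} (hy : y ∈ KZ.openOrderedSimplex k) : 0 < hiEdge m y := by
  unfold hiEdge
  split_ifs
  · exact hy.1 _
  · exact one_pos

/-- The upper edge is at most `1`. -/
theorem hiEdge_le_one {y : Fin k → ℝ} (hy : y ∈ KZ.openOrderedSimplex k) : hiEdge m y ≤ 1 := by
  unfold hiEdge
  split_ifs
  · exact (hy.2.1 _).le
  · exact le_rfl

/-- The coordinates from the slot on lie below the upper edge. -/
theorem lt_hiEdge {y : Fin k → ℝ} (hy : y ∈ KZ.openOrderedSimplex k) {j : Fin k}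
    (hj : m ≤ Fin.castSucc j) : y j < hiEdge m y := by
  have hj' : (m : ℕ) ≤ (j : ℕ) := by simpa [Fin.le_def] using hj
  unfold hiEdge
  split_ifs with h
  · exact hy.2.2 (Fin.lt_def.2 (by simp; omega))
  · exact hy.2.1 j

/-- The coordinates before the slot lie above the upper edge. -/
theorem hiEdge_le {y : Fin k → ℝ} (hy : y ∈ KZ.openOrderedSimplex k) {j : Fin k}
    (hj : Fin.castSucc j < m) : hiEdge m y ≤ y j := by
  have hj' : (j : ℕ) < (m : ℕ) := by simpa [Fin.lt_def] using hj
  have h : 0 < (m : ℕ) := by omega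
  have : hiEdge m y = y ⟨(m : ℕ) - 1, by omega⟩ := by simp [hiEdge, h]
  rw [this]
  exact hy.2.2.antitone (Fin.le_def.2 (by simp; omega))

/-- The lower edge is non-negative. -/
theorem loEdge_nonneg {y : Fin k → ℝ} (hy : y ∈ KZ.openOrderedSimplex k) : 0 ≤ loEdge m y := by
  unfold loEdge
  split_ifs
  · exact (hy.1 _).le
  · exact le_rfl

/-- The coordinates from the slot on lie below the lower edge (which is the first of them). -/
theorem le_loEdge {y : Fin k → ℝ} (hy : y ∈ KZ.openOrderedSimplex k) {j : Fin k}
    (hj : m ≤ Fin.castSucc j) : y j ≤ loEdge m y := by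
  have hj' : (m : ℕ) ≤ (j : ℕ) := by simpa [Fin.le_def] using hj
  have hmk : (m : ℕ) < k := lt_of_le_of_lt hj' j.2
  have : loEdge m y = y ⟨(m : ℕ), hmk⟩ := by simp [loEdge, hmk]
  rw [this]
  exact hy.2.2.antitone (Fin.le_def.2 (by simpa using hj'))

/-- The other coordinates of a point of the ordered `(k+1)`-simplex form a point of the ordered
`k`-simplex. -/
theorem removeNth_mem {t : Fin (k + 1) → ℝ} (ht : t ∈ KZ.openOrderedSimplex (k + 1)) :
    Fin.removeNth m t ∈ KZ.openOrderedSimplex k := by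
  rw [← Fin.insertNth_self_removeNth m t] at ht
  exact (insertNth_mem_openOrderedSimplex_iff.1 ht).1

/-- On the ordered simplex the slot coordinate lies strictly between its edges. -/
theorem edges_of_mem {t : Fin (k + 1) → ℝ} (ht : t ∈ KZ.openOrderedSimplex (k + 1)) :
    loEdge m (Fin.removeNth m t) < t m ∧ t m < hiC m t := by
  have hy := removeNth_mem m ht
  rw [← Fin.insertNth_self_removeNth m t] at ht
  have h := (insertNth_mem_iff_edges m hy (t m)).1 ht
  exact ⟨h.1, h.2⟩

/-- On the ordered simplex `hiC > 0`. -/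
theorem hiC_pos_of_mem {t : Fin (k + 1) → ℝ} (ht : t ∈ KZ.openOrderedSimplex (k + 1)) :
    0 < hiC m t :=
  (ht.1 m).trans (edges_of_mem m ht).2

/-! ### Scaled tuples and the charts on inserted tuples -/

/-- The tuple `y` with the coordinates from the slot `m` on multiplied by `c`. -/
def sc (c : ℝ) (y : Fin k → ℝ) : Fin k → ℝ := fun j => if m ≤ Fin.castSucc j then y j * c else y j

/-- The coordinates from the slot on are scaled. -/
theorem sc_apply_of_le {c : ℝ} {y : Fin k → ℝ} {j : Fin k} (h : m ≤ Fin.castSucc j) :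
    sc m c y j = y j * c := if_pos h

/-- The coordinates before the slot are kept. -/
theorem sc_apply_of_lt {c : ℝ} {y : Fin k → ℝ} {j : Fin k} (h : Fin.castSucc j < m) :
    sc m c y j = y j := if_neg (not_le.2 h)

/-- Scaling by `1` does nothing. -/
@[simp] theorem sc_one (y : Fin k → ℝ) : sc m 1 y = y := by
  ext j
  unfold sc
  split_ifs <;> simp

/-- Scaling does not move the upper edge. -/
@[simp] theorem hiEdge_sc (c : ℝ) (y : Fin k → ℝ) : hiEdge m (sc m c y) = hiEdge m y := by
  unfold hiEdge
  split_ifs with h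
  · exact sc_apply_of_lt m (by rw [Fin.lt_def, Fin.val_castSucc]; exact Nat.sub_lt h one_pos)
  · rfl

/-- Scaling scales the lower edge. -/
theorem loEdge_sc (c : ℝ) (y : Fin k → ℝ) : loEdge m (sc m c y) = loEdge m y * c := by
  unfold loEdge
  split_ifs with h
  · exact sc_apply_of_le m (Fin.le_def.2 (by simp))
  · simp

/-- **Scaled tuples stay in the ordered simplex** as long as the scaled coordinates stay below the
upper edge. [folklore] -/
theorem sc_mem {y : Fin k → ℝ} (hy : y ∈ KZ.openOrderedSimplex k) {c : ℝ} (hc : 0 < c)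
    (hcy : ∀ j : Fin k, m ≤ Fin.castSucc j → y j * c < hiEdge m y) :
    sc m c y ∈ KZ.openOrderedSimplex k := by
  have hy' := hy
  obtain ⟨h0, h1, hanti⟩ := hy'
  refine ⟨fun j => ?_, fun j => ?_, fun a b hab => ?_⟩
  · unfold sc
    split_ifs
    · exact mul_pos (h0 j) hc
    · exact h0 j
  · unfold sc
    split_ifs with hj
    · exact (hcy j hj).trans_le (hiEdge_le_one m hy)
    · exact h1 j
  · show sc m c y b < sc m c y a
    by_cases ha : m ≤ Fin.castSucc a
    · have hb : m ≤ Fin.castSucc b := ha.trans (Fin.castSucc_lt_castSucc_iff.2 hab).le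
      rw [sc_apply_of_le m ha, sc_apply_of_le m hb]
      exact mul_lt_mul_of_pos_right (hanti hab) hc
    · rw [sc_apply_of_lt m (not_le.1 ha)]
      by_cases hb : m ≤ Fin.castSucc b
      · rw [sc_apply_of_le m hb]
        exact (hcy b hb).trans_le (hiEdge_le m hy (not_le.1 ha))
      · rw [sc_apply_of_lt m (not_le.1 hb)]
        exact hanti hab

/-- **The chart on an inserted tuple**: the slot value is kept and the tuple is scaled by `H/u`. -/
theorem dch_insertNth (u : ℝ) (y : Fin k → ℝ) :
    dch m (Fin.insertNth m u y) = Fin.insertNth m u (sc m (hiEdge m y / u) y) := by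
  rw [Fin.eq_insertNth_iff]
  refine ⟨by simp, ?_⟩
  ext j
  rw [Fin.removeNth_apply]
  by_cases hj : m ≤ Fin.castSucc j
  · rw [sc_apply_of_le m hj, dch_apply_of_lt m ((Fin.lt_succAbove_iff_le_castSucc m j).2 hj),
      Fin.insertNth_apply_succAbove, Fin.insertNth_apply_same, hiC_insertNth]
    ring
  · have hj' := not_le.1 hj
    rw [sc_apply_of_lt m hj', dch_apply_of_le m, Fin.insertNth_apply_succAbove]
    rw [Fin.succAbove_of_castSucc_lt _ _ hj']
    exact hj'.le

/-- **The inverse chart on an inserted tuple**: the slot value is kept and the tuple is scaled by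
`u/H`. -/
theorem dinv_insertNth (u : ℝ) (y : Fin k → ℝ) :
    dinv m (Fin.insertNth m u y) = Fin.insertNth m u (sc m (u / hiEdge m y) y) := by
  rw [Fin.eq_insertNth_iff]
  refine ⟨by simp, ?_⟩
  ext j
  rw [Fin.removeNth_apply]
  by_cases hj : m ≤ Fin.castSucc j
  · rw [sc_apply_of_le m hj, dinv_apply_of_lt m ((Fin.lt_succAbove_iff_le_castSucc m j).2 hj),
      Fin.insertNth_apply_succAbove, Fin.insertNth_apply_same, hiC_insertNth]
    ring
  · have hj' := not_le.1 hj
    rw [sc_apply_of_lt m hj', dinv_apply_of_le m, Fin.insertNth_apply_succAbove]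
    rw [Fin.succAbove_of_castSucc_lt _ _ hj']
    exact hj'.le

/-! ### The straightened simplex: the open band over the ordered `k`-simplex -/

/-- The straightened simplex: the other coordinates in the ordered `k`-simplex, the slot coordinate
strictly between `0` and the upper edge. -/
def oband : Set (Fin (k + 1) → ℝ) :=
  {t | Fin.removeNth m t ∈ KZ.openOrderedSimplex k ∧ 0 < t m ∧ t m < hiC m t}

/-- The closed band: the slot coordinate between `0` and the upper edge (closed). -/
def cband0 : Set (Fin (k + 1) → ℝ) :=
  {t | Fin.removeNth m t ∈ KZ.openOrderedSimplex k ∧ 0 ≤ t m ∧ t m ≤ hiC m t}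

/-- The open band lies in the closed band. -/
theorem oband_subset_cband0 : oband m ⊆ cband0 (k := k) m :=
  fun _ ht => ⟨ht.1, ht.2.1.le, ht.2.2.le⟩

/-- Membership of an inserted tuple in the open band. -/
theorem insertNth_mem_oband {u : ℝ} {y : Fin k → ℝ} :
    Fin.insertNth m u y ∈ oband m ↔ y ∈ KZ.openOrderedSimplex k ∧ 0 < u ∧ u < hiEdge m y := by
  simp [oband]

/-- Membership of an inserted tuple in the closed band. -/
theorem insertNth_mem_cband0 {u : ℝ} {y : Fin k → ℝ} :
    Fin.insertNth m u y ∈ cband0 m ↔ y ∈ KZ.openOrderedSimplex k ∧ 0 ≤ u ∧ u ≤ hiEdge m y := by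
  simp [cband0]

/-- **The chart maps the simplex into the band.** [folklore] -/
theorem dch_mem_oband {t : Fin (k + 1) → ℝ} (ht : t ∈ KZ.openOrderedSimplex (k + 1)) :
    dch m t ∈ oband m := by
  have hy := removeNth_mem m ht
  obtain ⟨hlo, hhi⟩ := edges_of_mem m ht
  rw [hiC] at hhi
  have hu : 0 < t m := ht.1 m
  rw [← Fin.insertNth_self_removeNth m t, dch_insertNth, insertNth_mem_oband, hiEdge_sc]
  refine ⟨sc_mem m hy (div_pos (hiEdge_pos m hy) hu) fun j hj => ?_, hu, hhi⟩
  have hlt : Fin.removeNth m t j < t m := (le_loEdge m hy hj).trans_lt hlo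
  calc Fin.removeNth m t j * (hiEdge m (Fin.removeNth m t) / t m)
      < t m * (hiEdge m (Fin.removeNth m t) / t m) :=
        mul_lt_mul_of_pos_right hlt (div_pos (hiEdge_pos m hy) hu)
    _ = hiEdge m (Fin.removeNth m t) := by field_simp

/-- **The fibre points**: for `y` in the ordered `k`-simplex and `0 < u < hiEdge m y`, the point
`dinv m (insertNth m u y)` lies in the ordered `(k+1)`-simplex. [folklore] -/
theorem dinv_insertNth_mem {y : Fin k → ℝ} (hy : y ∈ KZ.openOrderedSimplex k) {u : ℝ}
    (hu : 0 < u) (huh : u < hiEdge m y) :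
    dinv m (Fin.insertNth m u y) ∈ KZ.openOrderedSimplex (k + 1) := by
  have hh := hiEdge_pos m hy
  have hc : 0 < u / hiEdge m y := div_pos hu hh
  have hsc : sc m (u / hiEdge m y) y ∈ KZ.openOrderedSimplex k := by
    refine sc_mem m hy hc fun j hj => ?_
    calc y j * (u / hiEdge m y) < hiEdge m y * (u / hiEdge m y) :=
          mul_lt_mul_of_pos_right (lt_hiEdge m hy hj) hc
      _ = u := by field_simp
      _ < hiEdge m y := huh
  rw [dinv_insertNth, insertNth_mem_iff_edges m hsc, loEdge_sc, hiEdge_sc]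
  refine ⟨?_, huh⟩
  calc loEdge m y * (u / hiEdge m y) < hiEdge m y * (u / hiEdge m y) :=
        mul_lt_mul_of_pos_right (loEdge_lt_hiEdge m hy) hc
    _ = u := by field_simp

/-- The inverse chart maps the band into the simplex. [folklore] -/
theorem dinv_mem_simplex {t : Fin (k + 1) → ℝ} (ht : t ∈ oband m) :
    dinv m t ∈ KZ.openOrderedSimplex (k + 1) := by
  rw [← Fin.insertNth_self_removeNth m t] at ht ⊢
  obtain ⟨hy, hu, huh⟩ := (insertNth_mem_oband m).1 ht
  exact dinv_insertNth_mem m hy hu huh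

/-- **The image of the ordered simplex under the dilation chart is the open band.** [folklore] -/
theorem image_dch : dch m '' KZ.openOrderedSimplex (k + 1) = oband m := by
  apply Subset.antisymm
  · rintro _ ⟨t, ht, rfl⟩
    exact dch_mem_oband m ht
  · intro t ht
    exact ⟨dinv m t, dinv_mem_simplex m ht, dch_dinv m ht.2.1.ne' (ht.2.1.trans ht.2.2).ne'⟩

/-! ### Reading the bands through the relabelling `m ↦ last` -/

/-- Reading through `reix m` turns the open band over the ordered simplex (last coordinate between
`0` and the upper edge) into `oband m`. -/
theorem comp_reix_mem_oband_iff (w : Fin (k + 1) → ℝ) :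
    (fun i => w (reix m i)) ∈ oband m ↔ Fin.init w ∈ KZ.openOrderedSimplex k ∧
      0 < w (Fin.last k) ∧ w (Fin.last k) < hiEdge m (Fin.init w) := by
  rw [comp_reix_eq_insertNth, insertNth_mem_oband]

/-- Reading through `reix m` turns the closed band `KZlog.band Δᵏ 0 hiEdge` into `cband0 m`. -/
theorem comp_reix_mem_cband0_iff (w : Fin (k + 1) → ℝ) :
    (fun i => w (reix m i)) ∈ cband0 m ↔
      w ∈ KZlog.band (KZ.openOrderedSimplex k) (fun _ => 0) (hiEdge m) := by
  rw [comp_reix_eq_insertNth, insertNth_mem_cband0, KZlog.mem_band]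

/-- The closed band is `ℚ`-semialgebraic. [cite: BochnakCosteRoy1998, §2.2] -/
theorem isSemialgebraic_cband0 : IsSemialgebraic ℚ (cband0 (k := k) m) := by
  have hS := KZ.isSemialgebraic_openOrderedSimplex k
  have h0 : IsSemialgebraicFunOn ℚ (KZ.openOrderedSimplex k) (fun _ : Fin k → ℝ => (0:ℝ)) := by
    simpa using isSemialgebraicFunOn_const_ratCast hS 0
  have hb : IsSemialgebraic ℚ (KZlog.band (KZ.openOrderedSimplex k) (fun _ => 0) (hiEdge m)) :=
    KZlog.isSemialgebraic_band h0 (isSemialgebraicFunOn_hiEdge hS m)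
  have h := hb.preimage_comp (reix m).symm
  convert h using 1
  ext z
  rw [mem_preimage, ← comp_reix_mem_cband0_iff m]
  simp [Function.comp]

/-- The open band is `ℚ`-semialgebraic. [cite: BochnakCosteRoy1998, §2.2] -/
theorem isSemialgebraic_oband : IsSemialgebraic ℚ (oband (k := k) m) := by
  have h1 : IsSemialgebraic ℚ {t : Fin (k + 1) → ℝ | Fin.removeNth m t ∈ KZ.openOrderedSimplex k} :=
    (KZ.isSemialgebraic_openOrderedSimplex k).preimage_comp m.succAbove
  have h2 : IsSemialgebraic ℚ {t : Fin (k + 1) → ℝ | 0 < t m} := by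
    simpa using isSemialgebraic_setOf_eval_pos (k := ℚ) (R := ℝ) (X m : MvPolynomial (Fin (k + 1)) ℚ)
  have h3 : IsSemialgebraic ℚ {t : Fin (k + 1) → ℝ | t m < hiC m t} := by
    by_cases hm : 0 < (m : ℕ)
    · have h := isSemialgebraic_setOf_eval_pos (k := ℚ) (R := ℝ)
        (X ⟨(m : ℕ) - 1, by omega⟩ - X m : MvPolynomial (Fin (k + 1)) ℚ)
      convert h using 1
      ext t
      simp [hiC_eq, hm, sub_pos]
    · have h := isSemialgebraic_setOf_eval_pos (k := ℚ) (R := ℝ)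
        (1 - X m : MvPolynomial (Fin (k + 1)) ℚ)
      convert h using 1
      ext t
      simp [hiC_eq, hm, sub_pos]
  have : oband m = {t : Fin (k + 1) → ℝ | Fin.removeNth m t ∈ KZ.openOrderedSimplex k} ∩
      {t | 0 < t m} ∩ {t | t m < hiC m t} := by
    ext t
    simp [oband, and_assoc]
  rw [this]
  exact (h1.inter h2).inter h3

/-- The open band is Lebesgue measurable. -/
theorem measurableSet_oband : MeasurableSet (oband (k := k) m) :=
  (isSemialgebraic_oband m).measurableSet_holds

end Dilation

/-- **Registered sub-goal `stub_dilationNLAux3`** of `stub_dilationNL` (the upper edge of the axis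
fibre of the ordered simplex is positive, `Dilation.hiEdge_pos`). [folklore] -/
theorem stub_dilationNLAux3 : ∀ (k : ℕ) (m : Fin (k + 1)) (y : Fin k → ℝ), y ∈ Literature.NumberTheory.Transcendental.KZ.openOrderedSimplex k → 0 < Summit.KontsevichZagierPeriods.DihedralNormalForm.VertexSplitting.hiEdge m y :=
  fun _ m _ hy => Dilation.hiEdge_pos m hy

end Summit.KontsevichZagierPeriods.DihedralNormalForm.TorusDescent
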